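import Summits.QuantumFields.YangMills.Theorems.F4SubCurvatureDoorLowDegreeChannels
import Summits.QuantumFields.YangMills.Theorems.F4SubCurvatureDoorChannelSymmetry
import Literature.LinearAlgebra.UnisolventPoints
import Mathlib
import HarnessLib

/-!
# Route `F4SubCurvatureDoor`, crux ⟨stmt-QuantumFields-23125⟩ `RationalToGeneral`: LINE g18-A v5 — CSF build-plan step C2
# «TOP-CHANNEL COEFFICIENTS»: the frozen-radius channel of a class kernel in a basis of `W(F₄)`-invariant harmonics, with
# continuous coefficients carrying the sub-curvature budget (C2(ii) + C2(iii) assembled; def-free)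

Owner ym-idea-3 g18's build plan for the registered stub `stub_channelShellForm` (`Cruxes/RationalToGeneral/Lines/sextic_channel_stubplans.md`
§4, step C2 «TopChannelCoefficients»): under the binders of `ChannelShellForm` (a class kernel `K` with a finite harmonic channel expansion
`K(x) = Σ_k g_k(‖x‖²) H_k(x)` off the origin — the profiles `g_k` are ARBITRARY functions, the `H_k` possibly linearly DEPENDENT), the
degree-`L` channel `T_L(x) = Σ_{d_k = L} g_k(‖x‖²) H_k(x)` can be written `T_L(x) = Σ_a c_a(‖x‖)·H̃_a(x)` with

* `H̃_a` a LINEARLY INDEPENDENT finite family of harmonic homogeneous polynomials of degree `L`, each invariant (at the level of evaluations)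
  under every signed permutation of the axes and every isometry preserving `D₄` — i.e. a basis of the space spanned by the frozen-radius
  channels `P_r = Σ_{d_k = L} g_k(r²)·H_k`, `r > 0`, which are `W(F₄)`-invariant by C2(i) ✓`F4SubCurvatureDoorLowDegreeChannels.channel_eval_comp_eq_of_invariant`;
* `c_a` CONTINUOUS on `(0,∞)` with the budget `r^{L+8} c_a(r) → 0` as `r → 0⁺` — by C2(iii): unisolvent points `ω_i ∈ S³` for a basis `B_j` of
  `U = span{H_k}` (✓`F4SubCurvatureDoorChannelSymmetry.exists_sphere_points_det_ne_zero`) express the `B`-coordinates of the rescaled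
  frozen-radius polynomial `Q̃_r = Σ_k g_k(r²) r^{d_k}·H_k` (whose values on `S³` are `K(rω)`) as `Σ_i (M⁻¹)_{ji} K(rω_i)`
  (✓`Literature.LinearAlgebra.coeff_eq_sum_inv_mul_eval`), and `P_r = r^{−L}·(degree-L component of Q̃_r)`;
* and the REALITY needed by `ChannelShellForm`: a polynomial invariant under the time flip `x₀ ↦ −x₀` takes real values at the forward null
  momenta `(i‖q⃗‖, q⃗)` (`im_aeval_null_eq_zero_of_timeFlip`), so `(nullEval (H̃ a) q⃗).im = 0`.

Main theorem ★ `exists_topChannel_coefficients` (all binders spelled out; uses continuity off `0`, the budget and the two symmetry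
conjuncts of `InClass`; NOT reflection positivity, NOT the bound outside the unit ball).  What remains of `ChannelShellForm` after this
file and ✓`F4SubCurvatureDoorLowDegreeChannels` (degrees `1…5`) is exactly the ANALYTIC CORE C3–C5 of the build plan for `L ≥ 6`: the
Laplace–Fourier channel disintegration `c_a(r) = C(r) ∫ φ(Mr) dρ_a(M)`, the shell cone and the budget transfer to the measures.
THEOREMS ONLY; Mathlib + tree; no `sorry`; standard axioms.  HONEST LABEL: linear-algebra/topology bookkeeping of an OPEN XL stub; C3 (the
long pole), T1″ (the wall), ⟨23125⟩ / ⟨23035⟩, rung R2d and the summit remain OPEN; the Yang–Mills mass gap is NOT proved; no summit is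
proved by a line.  Seat `ym-line-frs-p2` g14 (free hands), `--supports stmt-QuantumFields-23125`.
[cite: AxlerBourdonRamey2001, Thm. 5.7] [cite: Cheney1982, Ch. 3 Problem 23]
-/

set_option autoImplicit false

noncomputable section

namespace Summit.QuantumFields.YangMills.Theorems.F4SubCurvatureDoorTopChannelCoefficients

open MvPolynomial Filter
open scoped BigOperators Topology
open Literature.MathematicalPhysics.QuantumLattice (siteToE)
open Literature.LinearAlgebra (evalMatrix coeff_eq_sum_inv_mul_eval)
open Summit.QuantumFields.YangMills.Cruxes.OSLegsAtWeakCouplingC.Sketch (IsSignedPerm)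
open Summit.QuantumFields.YangMills.Theorems.F4SubCurvatureDoorGlobalReduction
  (reflection_single_apply isSignedPerm_reflection_single)
open Summit.QuantumFields.YangMills.Theorems.F4SubCurvatureDoorHarmonicSphere (eval_smul_of_isHomogeneous)
open Summit.QuantumFields.YangMills.Theorems.F4SubCurvatureDoorChannelSymmetry
  (homogeneousComponent_sum_smul_of_isHomogeneous exists_sphere_points_det_ne_zero)
open Summit.QuantumFields.YangMills.Theorems.F4SubCurvatureDoorLowDegreeChannels (channel_eval_comp_eq_of_invariant)
open Summit.QuantumFields.YangMills.Theorems.F4SubCurvatureDoorLowDegreeInvariants (bind₁_signs_eq_self)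

/-! ## § 1. Reality at the forward null momenta from time-flip invariance -/

/-- **Reality at the null momenta.**  A real polynomial on `ℝ⁴` invariant (at the level of evaluations) under the time flip
`x₀ ↦ −x₀` takes REAL values at every forward null momentum `(i‖q⃗‖, q⃗)`, `q⃗ ∈ ℝ³`: complex conjugation acts on the evaluation
point as the time flip. [folklore] -/
theorem im_aeval_null_eq_zero_of_timeFlip (P : MvPolynomial (Fin 4) ℝ)
    (hflip : ∀ y : Fin 4 → ℝ, eval (fun j => (if j = (0 : Fin 4) then (-1 : ℝ) else 1) * y j) P = eval y P)
    (q : EuclideanSpace ℝ (Fin 3)) :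
    (aeval (Fin.cons (Complex.I * (‖q‖ : ℂ)) (fun j : Fin 3 => ((q j : ℝ) : ℂ))) P).im = 0 := by
  set z : Fin 4 → ℂ := Fin.cons (Complex.I * (‖q‖ : ℂ)) (fun j : Fin 3 => ((q j : ℝ) : ℂ)) with hz
  -- the time flip is a polynomial identity
  have hP : bind₁ (fun j => C (if j = (0 : Fin 4) then (-1 : ℝ) else 1) * X j) P = P :=
    bind₁_signs_eq_self (fun j => if j = (0 : Fin 4) then (-1 : ℝ) else 1) hflip
  -- conjugation of the evaluation point is the time flip
  have hconj : (fun j => starRingEnd ℂ (z j)) = fun j => aeval z (C (if j = (0 : Fin 4) then (-1 : ℝ) else 1) * X j) := by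
    funext j
    rw [map_mul, aeval_C, aeval_X]
    refine Fin.cases ?_ (fun i => ?_) j
    · simp [hz, Complex.conj_ofReal]
    · simp [hz, Complex.conj_ofReal]
  -- conjugation fixes the real coefficients
  have hfix : (starRingEnd ℂ).comp (algebraMap ℝ ℂ) = algebraMap ℝ ℂ :=
    RingHom.ext fun t => by simp [Complex.conj_ofReal]
  have h1 : starRingEnd ℂ (aeval z P) = aeval z P := by
    rw [map_aeval, hfix, hconj]
    rw [show eval₂Hom (algebraMap ℝ ℂ) (fun j => aeval z (C (if j = (0 : Fin 4) then (-1 : ℝ) else 1) * X j)) P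
        = aeval (fun j => aeval z (C (if j = (0 : Fin 4) then (-1 : ℝ) else 1) * X j)) P from rfl, ← aeval_bind₁, hP]
  have h2 := congrArg Complex.im h1
  rw [Complex.conj_im] at h2
  linarith

/-! ## § 2. The top-channel coefficients -/

/-- ★ **TOP-CHANNEL COEFFICIENTS (CSF build plan C2).**  For a kernel `K : ℝ⁴ → ℝ` continuous off the origin, with the sub-curvature
budget `‖x‖⁸K(x) → 0`, invariant under the signed permutations of the axes and under the isometries preserving `D₄`, and a finite harmonic
channel expansion `K(x) = Σ_k g_k(‖x‖²) H_k(x)` off the origin (`H_k` harmonic homogeneous of degree `d_k`; `g_k` arbitrary, `H_k` possibly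
dependent), and for every degree `L`: there are finitely many LINEARLY INDEPENDENT harmonic homogeneous degree-`L` polynomials `H̃_a`, each
invariant under all these isometries at the level of evaluations, and coefficient functions `c_a`, CONTINUOUS on `(0,∞)` with
`r^{L+8} c_a(r) → 0` as `r → 0⁺`, such that `Σ_{d_k = L} g_k(‖x‖²) H_k(x) = Σ_a c_a(‖x‖) H̃_a(x)` for every `x ≠ 0`.
[cite: AxlerBourdonRamey2001, Thm. 5.7] [cite: Cheney1982, Ch. 3 Problem 23] -/
theorem exists_topChannel_coefficients {ι : Type*} [Fintype ι] (K : EuclideanSpace ℝ (Fin 4) → ℝ)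
    (hcont : ContinuousOn K {x | x ≠ 0})
    (hbud : Tendsto (fun x : EuclideanSpace ℝ (Fin 4) => ‖x‖ ^ 8 * K x) (𝓝[≠] 0) (𝓝 0))
    (hB : ∀ R : EuclideanSpace ℝ (Fin 4) ≃ₗᵢ[ℝ] EuclideanSpace ℝ (Fin 4), IsSignedPerm R → ∀ x, K (R x) = K x)
    (hlat : ∀ R : EuclideanSpace ℝ (Fin 4) ≃ₗᵢ[ℝ] EuclideanSpace ℝ (Fin 4),
      (∀ z : Fin 4 → ℤ, Even (∑ i, z i) → ∃ w : Fin 4 → ℤ, Even (∑ i, w i) ∧ R (siteToE z) = siteToE w) →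
      ∀ x, K (R x) = K x)
    (H : ι → MvPolynomial (Fin 4) ℝ) (d : ι → ℕ) (g : ι → ℝ → ℝ)
    (hH : ∀ k, (H k).IsHomogeneous (d k)) (hharm : ∀ k, ∑ i, pderiv i (pderiv i (H k)) = 0)
    (hexp : ∀ x : EuclideanSpace ℝ (Fin 4), x ≠ 0 → K x = ∑ k, g k (‖x‖ ^ 2) * eval (fun i => x i) (H k))
    (L : ℕ) :
    ∃ (n : ℕ) (Ht : Fin n → MvPolynomial (Fin 4) ℝ) (c : Fin n → ℝ → ℝ),
      (∀ a, (Ht a).IsHomogeneous L) ∧ (∀ a, ∑ i, pderiv i (pderiv i (Ht a)) = 0) ∧ LinearIndependent ℝ Ht ∧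
      (∀ a (R : EuclideanSpace ℝ (Fin 4) ≃ₗᵢ[ℝ] EuclideanSpace ℝ (Fin 4)), IsSignedPerm R →
        ∀ y : EuclideanSpace ℝ (Fin 4), eval (fun i => (R y) i) (Ht a) = eval (fun i => y i) (Ht a)) ∧
      (∀ a (R : EuclideanSpace ℝ (Fin 4) ≃ₗᵢ[ℝ] EuclideanSpace ℝ (Fin 4)),
        (∀ z : Fin 4 → ℤ, Even (∑ i, z i) → ∃ w : Fin 4 → ℤ, Even (∑ i, w i) ∧ R (siteToE z) = siteToE w) →
        ∀ y : EuclideanSpace ℝ (Fin 4), eval (fun i => (R y) i) (Ht a) = eval (fun i => y i) (Ht a)) ∧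
      (∀ a, ContinuousOn (c a) (Set.Ioi 0)) ∧
      (∀ a, Tendsto (fun r : ℝ => r ^ (L + 8) * c a r) (𝓝[>] 0) (𝓝 0)) ∧
      (∀ x : EuclideanSpace ℝ (Fin 4), x ≠ 0 →
        ∑ k ∈ Finset.univ.filter (fun k => d k = L), g k (‖x‖ ^ 2) * eval (fun i => x i) (H k)
          = ∑ a, c a ‖x‖ * eval (fun i => x i) (Ht a)) := by
  classical
  /- 1. The frozen-radius channel polynomials `P r` and their symmetries. -/
  let P : ℝ → MvPolynomial (Fin 4) ℝ := fun r => ∑ k ∈ Finset.univ.filter (fun k => d k = L), g k (r ^ 2) • H k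
  have hevalP : ∀ (r : ℝ) (y : Fin 4 → ℝ),
      eval y (P r) = ∑ k ∈ Finset.univ.filter (fun k => d k = L), g k (r ^ 2) * eval y (H k) := by
    intro r y
    simp only [P, map_sum, smul_eval]
  have hPsym : ∀ R : EuclideanSpace ℝ (Fin 4) ≃ₗᵢ[ℝ] EuclideanSpace ℝ (Fin 4), (∀ x, K (R x) = K x) →
      ∀ r, 0 < r → ∀ y : EuclideanSpace ℝ (Fin 4), eval (fun i => (R y) i) (P r) = eval (fun i => y i) (P r) := by
    intro R hinv r hr y
    rw [hevalP, hevalP]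
    exact channel_eval_comp_eq_of_invariant K R hinv H d g hH hharm hexp L hr y
  /- 2. The Laplacian as a linear map and the graded pieces. -/
  let Δ : MvPolynomial (Fin 4) ℝ →ₗ[ℝ] MvPolynomial (Fin 4) ℝ :=
    ∑ i : Fin 4, (pderiv i).toLinearMap ∘ₗ (pderiv i).toLinearMap
  have hΔ : ∀ Q, Δ Q = ∑ i, pderiv i (pderiv i Q) := fun Q => by
    simp [Δ, LinearMap.sum_apply]
  /- 3. The space `W` spanned by the frozen-radius channels, inside `U = span{H_k}`. -/
  let U : Submodule ℝ (MvPolynomial (Fin 4) ℝ) := Submodule.span ℝ (Set.range H)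
  let W : Submodule ℝ (MvPolynomial (Fin 4) ℝ) := Submodule.span ℝ (Set.range fun r : Set.Ioi (0 : ℝ) => P r)
  haveI : FiniteDimensional ℝ U := FiniteDimensional.span_of_finite ℝ (Set.finite_range H)
  have hWU : W ≤ U := by
    refine Submodule.span_le.mpr ?_
    rintro _ ⟨r, rfl⟩
    exact Submodule.sum_mem _ fun k _ => Submodule.smul_mem _ _ (Submodule.subset_span ⟨k, rfl⟩)
  haveI : FiniteDimensional ℝ W := Submodule.finiteDimensional_of_le hWU
  -- `U` is harmonic; `W` is harmonic, homogeneous of degree `L`, and symmetric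
  have hUharm : U ≤ LinearMap.ker Δ := by
    refine Submodule.span_le.mpr ?_
    rintro _ ⟨k, rfl⟩
    rw [SetLike.mem_coe, LinearMap.mem_ker, hΔ]
    exact hharm k
  have hWhom : W ≤ homogeneousSubmodule (Fin 4) ℝ L := by
    refine Submodule.span_le.mpr ?_
    rintro _ ⟨r, rfl⟩
    refine Submodule.sum_mem _ fun k hk => Submodule.smul_mem _ _ ?_
    rw [Finset.mem_filter] at hk
    rw [mem_homogeneousSubmodule, ← hk.2]
    exact hH k
  have hWsym : ∀ R : EuclideanSpace ℝ (Fin 4) ≃ₗᵢ[ℝ] EuclideanSpace ℝ (Fin 4), (∀ x, K (R x) = K x) →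
      ∀ Q ∈ W, ∀ y : EuclideanSpace ℝ (Fin 4), eval (fun i => (R y) i) Q = eval (fun i => y i) Q := by
    intro R hinv Q hQ
    induction hQ using Submodule.span_induction with
    | mem Q hQ =>
      obtain ⟨⟨r, hr⟩, rfl⟩ := hQ
      exact hPsym R hinv r hr
    | zero => intro y; simp
    | add Q₁ Q₂ _ _ h₁ h₂ => intro y; rw [map_add, map_add, h₁ y, h₂ y]
    | smul t Q _ h => intro y; rw [smul_eval, smul_eval, h y]
  /- 4. Bases. -/
  let bW := Module.finBasis ℝ W
  let bU := Module.finBasis ℝ U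
  set n : ℕ := Module.finrank ℝ W with hn
  set m : ℕ := Module.finrank ℝ U with hm
  let Ht : Fin n → MvPolynomial (Fin 4) ℝ := fun a => (bW a : MvPolynomial (Fin 4) ℝ)
  let Bv : Fin m → MvPolynomial (Fin 4) ℝ := fun j => (bU j : MvPolynomial (Fin 4) ℝ)
  have hHtW : ∀ a, Ht a ∈ W := fun a => (bW a).2
  have hHtli : LinearIndependent ℝ Ht :=
    bW.linearIndependent.map' W.subtype (Submodule.ker_subtype W)
  have hBvli : LinearIndependent ℝ Bv :=
    bU.linearIndependent.map' U.subtype (Submodule.ker_subtype U)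
  have hBvharm : ∀ j, ∑ i, pderiv i (pderiv i (Bv j)) = 0 := fun j => by
    rw [← hΔ]
    exact LinearMap.mem_ker.mp (hUharm (bU j).2)
  /- 5. Unisolvent points on the unit sphere for the basis of `U`. -/
  obtain ⟨ω, hω⟩ := exists_sphere_points_det_ne_zero Bv hBvharm hBvli
  let F : Fin m → Metric.sphere (0 : EuclideanSpace ℝ (Fin 4)) 1 → ℝ :=
    fun j w => eval (fun l => (w : EuclideanSpace ℝ (Fin 4)) l) (Bv j)
  have hω' : (evalMatrix F ω).det ≠ 0 := hω
  set A : Matrix (Fin m) (Fin m) ℝ := (evalMatrix F ω)⁻¹ with hA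
  have hω1 : ∀ i, ‖(ω i : EuclideanSpace ℝ (Fin 4))‖ = 1 := fun i => by simp
  have hωne : ∀ i (r : ℝ), 0 < r → r • (ω i : EuclideanSpace ℝ (Fin 4)) ≠ 0 := by
    intro i r hr h0
    have := congrArg (fun v : EuclideanSpace ℝ (Fin 4) => ‖v‖) h0
    simp only [norm_smul, Real.norm_eq_abs, hω1, mul_one, norm_zero] at this
    exact hr.ne' (abs_eq_zero.1 this)
  -- point-value coordinates
  let γ : Fin m → ℝ → ℝ := fun j r => ∑ i, A j i * K (r • (ω i : EuclideanSpace ℝ (Fin 4)))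
  /- 6. The rescaled frozen-radius polynomial `Q̃ r = Σ_k g_k(r²) r^{d_k} H_k ∈ U` and its two expansions. -/
  let Qt : ℝ → MvPolynomial (Fin 4) ℝ := fun r => ∑ k, (g k (r ^ 2) * r ^ (d k)) • H k
  have hQtU : ∀ r, Qt r ∈ U := fun r =>
    Submodule.sum_mem _ fun k _ => Submodule.smul_mem _ _ (Submodule.subset_span ⟨k, rfl⟩)
  -- values on the unit sphere are the kernel's values on the sphere of radius `r`
  have hQtval : ∀ r, 0 < r → ∀ w : Metric.sphere (0 : EuclideanSpace ℝ (Fin 4)) 1,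
      eval (fun l => (w : EuclideanSpace ℝ (Fin 4)) l) (Qt r) = K (r • (w : EuclideanSpace ℝ (Fin 4))) := by
    intro r hr w
    have hw1 : ‖(w : EuclideanSpace ℝ (Fin 4))‖ = 1 := by simp
    have hwne : r • (w : EuclideanSpace ℝ (Fin 4)) ≠ 0 := by
      intro h0
      have := congrArg (fun v : EuclideanSpace ℝ (Fin 4) => ‖v‖) h0
      simp only [norm_smul, Real.norm_eq_abs, hw1, mul_one, norm_zero] at this
      exact hr.ne' (abs_eq_zero.1 this)
    rw [hexp _ hwne]
    simp only [Qt, map_sum, smul_eval, norm_smul, Real.norm_eq_abs, abs_of_pos hr, hw1, mul_one]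
    refine Finset.sum_congr rfl fun k _ => ?_
    have hsc : (fun i => (r • (w : EuclideanSpace ℝ (Fin 4))) i) = fun i => r * (w : EuclideanSpace ℝ (Fin 4)) i := by
      funext i; simp
    rw [hsc, eval_smul_of_isHomogeneous (hH k) r]
    ring
  -- the `Bv`-expansion of `Qt r` with the point-value coordinates `γ`
  have hQtγ : ∀ r, 0 < r → Qt r = ∑ j, γ j r • Bv j := by
    intro r hr
    -- actual coordinates in the basis `bU`
    set cU : Fin m → ℝ := fun j => bU.repr ⟨Qt r, hQtU r⟩ j with hcU
    have hrepr : Qt r = ∑ j, cU j • Bv j := by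
      have h := bU.sum_repr ⟨Qt r, hQtU r⟩
      have h' := congrArg (fun v : U => (v : MvPolynomial (Fin 4) ℝ)) h
      simp only [Submodule.coe_sum, Submodule.coe_smul] at h'
      exact h'.symm
    -- they coincide with `γ j r`
    have hcγ : ∀ j, cU j = γ j r := by
      intro j
      rw [coeff_eq_sum_inv_mul_eval hω' cU j]
      refine Finset.sum_congr rfl fun i _ => ?_
      congr 1
      rw [← hQtval r hr (ω i), hrepr]
      simp only [map_sum, smul_eval, F]
    rw [hrepr]
    exact Finset.sum_congr rfl fun j _ => by rw [hcγ j]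
  -- degree-`L` components: `r^L • P r = Σ_j γ_j(r) • (B_j)_L`
  have hcompP : ∀ r, homogeneousComponent L (Qt r) = r ^ L • P r := by
    intro r
    have h := homogeneousComponent_sum_smul_of_isHomogeneous Finset.univ H d (fun k => g k (r ^ 2) * r ^ (d k)) hH L
    simp only [Qt]
    rw [h, Finset.smul_sum]
    refine Finset.sum_congr rfl fun k hk => ?_
    rw [Finset.mem_filter] at hk
    rw [hk.2, smul_smul, mul_comm]
  have hPγ : ∀ r, 0 < r → P r = ∑ j, (r⁻¹ ^ L * γ j r) • homogeneousComponent L (Bv j) := by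
    intro r hr
    have hrL : r ^ L ≠ 0 := pow_ne_zero _ hr.ne'
    have h1 : r ^ L • P r = ∑ j, γ j r • homogeneousComponent L (Bv j) := by
      rw [← hcompP r, hQtγ r hr, map_sum]
      simp only [map_smul]
    have h2 : P r = r⁻¹ ^ L • (r ^ L • P r) := by
      rw [smul_smul, inv_pow, inv_mul_cancel₀ hrL, one_smul]
    rw [h2, h1, Finset.smul_sum]
    simp only [smul_smul]
  /- 7. The coefficient functionals. -/
  obtain ⟨Wc, hWc⟩ := W.exists_isCompl
  let π : MvPolynomial (Fin 4) ℝ →ₗ[ℝ] W := W.projectionOnto Wc hWc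
  let Λ : Fin n → MvPolynomial (Fin 4) ℝ →ₗ[ℝ] ℝ :=
    fun a => (Finsupp.lapply a) ∘ₗ (bW.repr.toLinearMap ∘ₗ π)
  let c : Fin n → ℝ → ℝ := fun a r => Λ a (P r)
  have hΛ : ∀ a Q, Λ a Q = bW.repr (π Q) a := fun a Q => rfl
  -- reconstruction on `W`
  have hrecon : ∀ r, 0 < r → ∑ a, c a r • Ht a = P r := by
    intro r hr
    have hPW : P r ∈ W := Submodule.subset_span ⟨⟨r, hr⟩, rfl⟩
    have hπ : π (P r) = ⟨P r, hPW⟩ := Submodule.projectionOnto_apply_of_mem_left hWc hPW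
    have h := bW.sum_repr ⟨P r, hPW⟩
    have h' := congrArg (fun v : W => (v : MvPolynomial (Fin 4) ℝ)) h
    simp only [Submodule.coe_sum, Submodule.coe_smul] at h'
    simp only [c, hΛ, hπ]
    exact h'
  -- the explicit formula on `(0,∞)`
  have hformula : ∀ a r, 0 < r → c a r = ∑ j, (r⁻¹ ^ L * γ j r) * Λ a (homogeneousComponent L (Bv j)) := by
    intro a r hr
    simp only [c]
    rw [hPγ r hr, map_sum]
    exact Finset.sum_congr rfl fun j _ => by rw [map_smul, smul_eq_mul]
  /- 8. Continuity of the point values and the budget along the rays. -/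
  have hγcont : ∀ j, ContinuousOn (γ j) (Set.Ioi 0) := by
    intro j
    refine continuousOn_finsetSum _ fun i _ => continuousOn_const.mul ?_
    exact hcont.comp (continuous_id.smul continuous_const).continuousOn fun r hr => hωne i r hr
  have hγbud : ∀ j, Tendsto (fun r : ℝ => r ^ 8 * γ j r) (𝓝[>] 0) (𝓝 0) := by
    intro j
    have hpath : ∀ i, Tendsto (fun r : ℝ => r • (ω i : EuclideanSpace ℝ (Fin 4))) (𝓝[>] 0) (𝓝[≠] 0) := by
      intro i
      refine tendsto_nhdsWithin_iff.2 ⟨?_, ?_⟩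
      · have h : Tendsto (fun r : ℝ => r • (ω i : EuclideanSpace ℝ (Fin 4))) (𝓝 0)
            (𝓝 ((0 : ℝ) • (ω i : EuclideanSpace ℝ (Fin 4)))) :=
          (continuous_id.smul continuous_const).tendsto 0
        rw [zero_smul] at h
        exact h.mono_left nhdsWithin_le_nhds
      · exact eventually_nhdsWithin_of_forall fun r (hr : 0 < r) => hωne i r hr
    have hterm : ∀ i, Tendsto (fun r : ℝ => r ^ 8 * K (r • (ω i : EuclideanSpace ℝ (Fin 4)))) (𝓝[>] 0) (𝓝 0) := by
      intro i
      refine ((hbud.comp (hpath i)).congr' ?_)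
      refine eventually_nhdsWithin_of_forall fun r (hr : 0 < r) => ?_
      simp only [Function.comp_apply, norm_smul, Real.norm_eq_abs, abs_of_pos hr, hω1, mul_one]
    have hsum : Tendsto (fun r : ℝ => ∑ i, A j i * (r ^ 8 * K (r • (ω i : EuclideanSpace ℝ (Fin 4)))))
        (𝓝[>] 0) (𝓝 (∑ i : Fin m, A j i * 0)) :=
      tendsto_finsetSum _ fun i _ => (hterm i).const_mul (A j i)
    simp only [mul_zero, Finset.sum_const_zero] at hsum
    refine hsum.congr fun r => ?_
    simp only [γ, Finset.mul_sum]
    exact Finset.sum_congr rfl fun i _ => by ring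
  /- 9. Assemble. -/
  refine ⟨n, Ht, c, fun a => ?_, fun a => ?_, hHtli, fun a R hR => hWsym R (hB R hR) (Ht a) (hHtW a),
    fun a R hR => hWsym R (hlat R hR) (Ht a) (hHtW a), fun a => ?_, fun a => ?_, fun x hx => ?_⟩
  · exact (mem_homogeneousSubmodule _ _).mp (hWhom (hHtW a))
  · rw [← hΔ]; exact LinearMap.mem_ker.mp (hUharm (hWU (hHtW a)))
  · -- continuity on `(0,∞)`
    have hc : ContinuousOn (fun r : ℝ => ∑ j, (r⁻¹ ^ L * γ j r) * Λ a (homogeneousComponent L (Bv j))) (Set.Ioi 0) := by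
      refine continuousOn_finsetSum _ fun j _ => ContinuousOn.mul ?_ continuousOn_const
      exact ((continuousOn_inv₀.mono fun r (hr : 0 < r) => hr.ne').pow L).mul (hγcont j)
    exact hc.congr fun r hr => hformula a r hr
  · -- budget
    have hlim : Tendsto (fun r : ℝ => ∑ j, (r ^ 8 * γ j r) * Λ a (homogeneousComponent L (Bv j))) (𝓝[>] 0)
        (𝓝 (∑ j : Fin m, 0 * Λ a (homogeneousComponent L (Bv j)))) :=
      tendsto_finsetSum _ fun j _ => (hγbud j).mul_const _
    simp only [zero_mul, Finset.sum_const_zero] at hlim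
    refine hlim.congr' ?_
    refine eventually_nhdsWithin_of_forall fun r (hr : 0 < r) => ?_
    show ∑ j, r ^ 8 * γ j r * Λ a (homogeneousComponent L (Bv j)) = r ^ (L + 8) * c a r
    rw [hformula a r hr, Finset.mul_sum]
    refine Finset.sum_congr rfl fun j _ => ?_
    have hrL : r ^ L ≠ 0 := pow_ne_zero _ hr.ne'
    calc r ^ 8 * γ j r * Λ a (homogeneousComponent L (Bv j))
        = (r ^ L * (r ^ L)⁻¹) * (r ^ 8 * γ j r * Λ a (homogeneousComponent L (Bv j))) := by
          rw [mul_inv_cancel₀ hrL, one_mul]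
      _ = r ^ (L + 8) * (r⁻¹ ^ L * γ j r * Λ a (homogeneousComponent L (Bv j))) := by
          rw [inv_pow, pow_add]; ring
  · -- the identity at `x ≠ 0`
    have hr : 0 < ‖x‖ := norm_pos_iff.mpr hx
    have h := congrArg (eval (fun i => x i)) (hrecon ‖x‖ hr)
    rw [hevalP] at h
    rw [← h]
    simp only [map_sum, smul_eval]

/-! ## § 3. Corollary: the invariant basis is real at the forward null momenta -/

/-- The time flip `x₀ ↦ −x₀` is a signed permutation of the axes (it is the coordinate mirror reflection `((ℝ ∙ e₀)ᗮ).reflection`);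
hence every polynomial invariant under all signed permutations at the level of evaluations is real at the forward null momenta —
the reality conjunct `(nullEval (H̃ a) q⃗).im = 0` of `ChannelShellForm` for the basis of `exists_topChannel_coefficients`. [folklore] -/
theorem im_aeval_null_eq_zero_of_signedPerm_invariant (P : MvPolynomial (Fin 4) ℝ)
    (hinv : ∀ R : EuclideanSpace ℝ (Fin 4) ≃ₗᵢ[ℝ] EuclideanSpace ℝ (Fin 4), IsSignedPerm R →
      ∀ y : EuclideanSpace ℝ (Fin 4), eval (fun i => (R y) i) P = eval (fun i => y i) P)
    (q : EuclideanSpace ℝ (Fin 3)) :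
    (aeval (Fin.cons (Complex.I * (‖q‖ : ℂ)) (fun j : Fin 3 => ((q j : ℝ) : ℂ))) P).im = 0 := by
  refine im_aeval_null_eq_zero_of_timeFlip P (fun y => ?_) q
  have h := hinv _ (isSignedPerm_reflection_single 0) (WithLp.toLp 2 y)
  have e : (fun j => ((ℝ ∙ (EuclideanSpace.single (0 : Fin 4) (1 : ℝ) : EuclideanSpace ℝ (Fin 4)))ᗮ.reflection
      (WithLp.toLp 2 y)) j) = fun j => (if j = (0 : Fin 4) then (-1 : ℝ) else 1) * y j := by
    funext j
    rw [reflection_single_apply]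
    by_cases hj : j = 0
    · simp [hj]
    · simp [hj]
  rw [e] at h
  exact h

end Summit.QuantumFields.YangMills.Theorems.F4SubCurvatureDoorTopChannelCoefficients

end
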